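import Summits.QuantumFields.BalabanUV.T4Continuum.Support.GradedWellSlice
import Summits.QuantumFields.BalabanUV.T4Continuum.Support.BalabanAveragedTowerApply

/-!
# T⁴ programme, spine node NE2 (U1a), sub-row Δ1 — THE GRADED WELL, file 4: TWO LEVELS `k → k+1` — the scalar and vector ROWS of
# the graded well are LEVEL-INDEPENDENT SETS (the anchors plant by `cpt`), so the gauge columns of consecutive levels are indexed alike
# (owner item O16-d, part 1: the row lifts `rowSLift`/`rowVLift` that (GW-B)/(GW-Bᵗ)/(GW-K) are stated with)

Row NE2 OWNER (unit `b2b-balaban-t4-ne2-p1`, gen 16), on files 1–3 (`GradedSubBlocks` p244783, `GradedSubBlocksRefine` p244956,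
`GradedWellData`, `GradedWellSlice`).  In O15 (`RegionGaugeResolventTower`) the gauge columns `B̂` were indexed by the UNIT blocks of the
region — the same finite set at every level — so `‖B̂_{k+1} − J_k·B̂_k‖` type-checked.  For the graded well the scalar rows at level `k` are
pairs `(i, z)`, `z` a scale-`s_i = L^{k−i}` anchor of the level-`k` torus; at level `k+1` the scale is `L·s_i` and the anchors are EXACTLY
the `cpt`-images («coarse point as a fine point», coordinates `× L`, `B5G183RateTorus.cpt`) of the level-`k` anchors (for `k ≥ m`).  THIS FILE
builds the bijections:

 * §1 `cpt` on anchors: `val_cpt'`, `cpt_tstep'` (no size hypothesis), `anchor_cpt`, `blockOf_cpt`, `par_cpt'`, `cpt_par_of_dvd`, `sGW_succ`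
   (`s_i(k+1) = L·s_i(k)` for `i ≤ k`);
 * §2 **`rowSLift (hk : m ≤ k) : RowS L M k m layer ≃ RowS L M (k+1) m layer`** and **`rowVLift (hk) : RowV L M k m layer ≃ RowV L M (k+1) m layer`**
   (the layer of the unit block and print's `st`-predicate are preserved: `cpt` commutes with `shiftAnc`);
 * §3 the LEVEL-`k`-INDEXED gauge data of level `k+1`: `QsGWnL hk := (QsGWn (k+1)).submatrix (rowSLift hk) id`, the columns
   `BhGW k := gaugeB gradT GOmGW QsGWn` and `BhGWL hk := (gaugeB … (k+1) …).submatrix id (rowSLift hk)`, `KGW`, `KGWL`, with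
   `regionGW_succ_eq_localGW_sub_sandwichL` (the split of level `k+1` written with level-`k` row indices — reindexing the middle index of a
   sandwich by an `Equiv` changes nothing).  File 5 (`GradedWellResolventTower`) states O15's transfer `hinjK ⟸ (L)(B)(Bᵗ)(K)` with these.

HONEST FRAMING (T4-DAG p. 1).  [folklore] index bookkeeping; no estimate; NE2 (U1a) NOT proved; spine PROVED 0/9 unchanged; NOT [B9] (3.16)/
(3.23)–(3.27) as printed; NOT infinite volume / mass gap / Clay.  HONEST DEPENDENCY: continuum YM on T⁴ ⇐ BetaPertH ∧ nine spine estimates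
(0/9 proved); BetaPertH ⇐ (D1) ∧ (D4) ∧ CAP+tail; G-an2-4 gates asym, D1 and NE2/3/4.  No `sorry`.
-/

noncomputable section

open scoped BigOperators ComplexConjugate Matrix Matrix.Norms.L2Operator
open Finset

namespace Summit.QuantumFields.BalabanUV.T4Continuum.GradedWellTwoLevel

open Literature.MathematicalPhysics.QuantumFieldTheory.Balaban1983to89.B5Prop11Plancherel (Tor fine unitVec)
open Literature.MathematicalPhysics.QuantumFieldTheory.Balaban1983to89.B5Block118 (tstep)
open Literature.MathematicalPhysics.QuantumFieldTheory.Balaban1983to89.B5Blocks16 (blockOf)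
open Literature.MathematicalPhysics.QuantumFieldTheory.Balaban1983to89.B5G183RateTorus (cpt)
open Literature.MathematicalPhysics.QuantumFieldTheory.Balaban1983to89.B5G183RateUnitTower (lev lev_neZero)
open Summit.QuantumFields.BalabanUV.T4Continuum
open Summit.QuantumFields.BalabanUV.T4Continuum.ScalarPlantingDefect (val_blockOf)
open Summit.QuantumFields.BalabanUV.T4Continuum.BalabanAveragedTowerModes (par val_par)
open Summit.QuantumFields.BalabanUV.T4Continuum.BalabanAveragedTowerApply (cpt_add natCast_mul_mod)
open Summit.QuantumFields.BalabanUV.T4Continuum.RegionGaugeProjection (gramK)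
open Summit.QuantumFields.BalabanUV.T4Continuum.RegionGaugeResolventSplit (gaugeB gaugeFixed_eq_localFixed_sub_sandwich)
open Summit.QuantumFields.BalabanUV.T4Continuum.GradedSubBlocks (Anchor Anc shiftAnc s_pos)
open Summit.QuantumFields.BalabanUV.T4Continuum.GradedWellData
open Summit.QuantumFields.BalabanUV.T4Continuum.GradedWellSlice (QsGWn regionGW_eq_normalised)

variable {d : ℕ}

/-! ## §1 `cpt` on anchors -/

section Cpt

variable (N L : ℕ) [NeZero N] [NeZero L] (M : Fin d → ℕ) [hM : ∀ μ, NeZero (M μ)]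

/-- the coordinate values of `cpt x`: `L·x_ν` (no wrap-around). [folklore] -/
theorem val_cpt' (x : Tor (fine N M)) (ν : Fin d) : (cpt N L M x ν).val = L * (x ν).val := by
  have hx : (x ν).val < N * M ν := ZMod.val_lt _
  have hlt : L * (x ν).val < fine (L * N) M ν := by
    show L * (x ν).val < L * N * M ν
    rw [mul_assoc]; exact Nat.mul_lt_mul_of_pos_left hx (Nat.pos_of_ne_zero (NeZero.ne L))
  show (((L * (x ν).val : ℕ) : ZMod (fine (L * N) M ν))).val = _
  rw [ZMod.val_cast_of_lt hlt]

omit [NeZero N] [NeZero L] hM in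
/-- `cpt (s e_μ) = (L s) e_μ`, for EVERY `s`. [folklore] -/
theorem cpt_tstep' (μ : Fin d) (s : ℕ) : cpt N L M (tstep (fine N M) μ s) = tstep (fine (L * N) M) μ (L * s) := by
  funext ν
  simp only [cpt, tstep]
  by_cases h : ν = μ
  · rw [if_pos h, if_pos h, ZMod.val_natCast, natCast_mul_mod]
  · rw [if_neg h, if_neg h, ZMod.val_zero, mul_zero, Nat.cast_zero]

/-- `cpt` of a scale-`s` anchor is a scale-`L·s` anchor. [folklore] -/
theorem anchor_cpt {s : ℕ} {z : Tor (fine N M)} (hz : Anchor (fine N M) s z) : Anchor (fine (L * N) M) (L * s) (cpt N L M z) := by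
  intro ν
  rw [val_cpt']
  exact Nat.mul_dvd_mul_left L (hz ν)

/-- `cpt` preserves the unit block. [folklore] -/
theorem blockOf_cpt (x : Tor (fine N M)) : blockOf (L * N) M (cpt N L M x) = blockOf N M x := by
  funext ν
  apply ZMod.val_injective
  rw [val_blockOf, val_blockOf, val_cpt', ← Nat.div_div_eq_div_mul,
    Nat.mul_div_cancel_left _ (Nat.pos_of_ne_zero (NeZero.ne L))]

/-- `par (cpt x) = x`. [folklore] -/
theorem par_cpt' (x : Tor (fine N M)) : par N L M (cpt N L M x) = x := by
  funext ν
  apply ZMod.val_injective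
  rw [val_par, val_cpt', Nat.mul_div_cancel_left _ (Nat.pos_of_ne_zero (NeZero.ne L))]

/-- a fine site with coordinates divisible by `L` is the `cpt` of its parent. [folklore] -/
theorem cpt_par_of_dvd {x : Tor (fine (L * N) M)} (hx : ∀ ν, L ∣ (x ν).val) : cpt N L M (par N L M x) = x := by
  funext ν
  apply ZMod.val_injective
  rw [val_cpt', val_par, Nat.mul_div_cancel' (hx ν)]

end Cpt

/-! ## §2 The row lifts -/

section Lift

variable (L : ℕ) [NeZero L] (M : Fin d → ℕ) [hM : ∀ μ, NeZero (M μ)] (k m : ℕ) (layer : Tor M → ℕ)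

omit [NeZero L] hM in
/-- `s_i(k+1) = L·s_i(k)` for `i ≤ k`. [folklore] -/
theorem sGW_succ {i : ℕ} (hi : i ≤ k) : sGW L (k + 1) i = L * sGW L k i := by
  show lev L (k + 1 - i) = L * lev L (k - i)
  rw [Nat.succ_sub hi]
  rfl

/-- the `cpt`-lift of a scale-`s_i(k)` anchor is a scale-`s_i(k+1)` anchor (`i ≤ k`). [folklore] -/
theorem anchor_lift {i : ℕ} (hi : i ≤ k) {z : TorK L M k} (hz : Anchor (fine (lev L k) M) (sGW L k i) z) :
    Anchor (fine (lev L (k + 1)) M) (sGW L (k + 1) i) (cpt (lev L k) L M z) := by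
  rw [sGW_succ L k hi]
  exact anchor_cpt (lev L k) L M hz

/-- … and conversely a scale-`s_i(k+1)` anchor has coordinates divisible by `L` and its parent is a scale-`s_i(k)` anchor. [folklore] -/
theorem anchor_par {i : ℕ} (hi : i ≤ k) {x : Tor (fine (L * lev L k) M)} (hx : Anchor (fine (L * lev L k) M) (sGW L (k + 1) i) x) :
    (∀ ν, L ∣ (x ν).val) ∧ Anchor (fine (lev L k) M) (sGW L k i) (par (lev L k) L M x) := by
  rw [sGW_succ L k hi] at hx
  refine ⟨fun ν => Dvd.dvd.trans (Dvd.intro _ rfl) (hx ν), fun ν => ?_⟩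
  obtain ⟨q, hq⟩ := hx ν
  rw [val_par, hq, mul_assoc, Nat.mul_div_cancel_left _ (Nat.pos_of_ne_zero (NeZero.ne L))]
  exact Dvd.intro _ rfl

/-- `cpt` preserves the unit block, tower spelling. [folklore] -/
theorem blockOf_cpt_lev (x : TorK L M k) : blockOf (lev L (k + 1)) M (cpt (lev L k) L M x) = blockOf (lev L k) M x :=
  blockOf_cpt (lev L k) L M x

/-- the lift of a scalar row (same layer index, `cpt`-planted anchor). [folklore] -/
def liftS (hk : m ≤ k) (p : RowS L M k m layer) : RowS L M (k + 1) m layer :=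
  ⟨⟨p.1.1, ⟨cpt (lev L k) L M p.1.2.1, anchor_lift L M k (le_trans (Nat.le_of_lt_succ p.1.1.isLt) hk) p.1.2.2⟩⟩, by
    show layer (blockOf (lev L (k + 1)) M (cpt (lev L k) L M p.1.2.1)) = p.1.1
    rw [blockOf_cpt_lev]
    exact p.2⟩

/-- the descent of a scalar row of level `k+1` (parent anchor). [folklore] -/
def dropS (hk : m ≤ k) (q : RowS L M (k + 1) m layer) : RowS L M k m layer :=
  ⟨⟨q.1.1, ⟨par (lev L k) L M q.1.2.1, (anchor_par L M k (le_trans (Nat.le_of_lt_succ q.1.1.isLt) hk) q.1.2.2).2⟩⟩, by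
    have h := (anchor_par L M k (le_trans (Nat.le_of_lt_succ q.1.1.isLt) hk) q.1.2.2).1
    show layer (blockOf (lev L k) M (par (lev L k) L M q.1.2.1)) = q.1.1
    have e1 := blockOf_cpt_lev L M k (par (lev L k) L M q.1.2.1)
    rw [cpt_par_of_dvd (lev L k) L M h] at e1
    rw [← e1]
    exact q.2⟩

/-- **THE SCALAR ROW LIFT** `RowS(k) ≃ RowS(k+1)` for `k ≥ m`. [folklore] -/
def rowSLift (hk : m ≤ k) : RowS L M k m layer ≃ RowS L M (k + 1) m layer where
  toFun := liftS L M k m layer hk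
  invFun := dropS L M k m layer hk
  left_inv p := Subtype.ext (Sigma.ext rfl (heq_of_eq (Subtype.ext (par_cpt' (lev L k) L M p.1.2.1))))
  right_inv q := Subtype.ext (Sigma.ext rfl (heq_of_eq (Subtype.ext
    (cpt_par_of_dvd (lev L k) L M (anchor_par L M k (le_trans (Nat.le_of_lt_succ q.1.1.isLt) hk) q.1.2.2).1))))

/-- `cpt` commutes with the next-anchor shift: `cpt (z + s e_μ) = cpt z + (L s) e_μ`. [folklore] -/
theorem cpt_shiftAnc {i : ℕ} (hi : i ≤ k) (μ : Fin d) (z : Anc (fine (lev L k) M) (sGW L k i)) :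
    (shiftAnc (fine (lev L (k + 1)) M) (sGW L (k + 1) i) (sGW_dvd L M (k + 1) i) μ
        ⟨cpt (lev L k) L M z.1, anchor_lift L M k hi z.2⟩).1
      = cpt (lev L k) L M (shiftAnc (fine (lev L k) M) (sGW L k i) (sGW_dvd L M k i) μ z).1 := by
  have e0 : ∀ w : Anc (fine (lev L (k + 1)) M) (sGW L (k + 1) i),
      (shiftAnc (fine (lev L (k + 1)) M) (sGW L (k + 1) i) (sGW_dvd L M (k + 1) i) μ w).1
        = w.1 + tstep (fine (lev L (k + 1)) M) μ (sGW L (k + 1) i) := fun w => rfl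
  have e1 : (shiftAnc (fine (lev L k) M) (sGW L k i) (sGW_dvd L M k i) μ z).1 = z.1 + tstep (fine (lev L k) M) μ (sGW L k i) := rfl
  rw [e0, e1, cpt_add, cpt_tstep']
  have key : ∀ (t : ℕ), t = L * sGW L k i → ∀ (w : TorK L M (k + 1)), w = cpt (lev L k) L M z.1 →
      w + tstep (fine (lev L (k + 1)) M) μ t = cpt (lev L k) L M z.1 + tstep (fine (L * lev L k) M) μ (L * sGW L k i) := by
    intro t ht w hw
    subst ht; subst hw
    rfl
  exact key _ (sGW_succ L k hi) _ rfl

/-- the lift of a vector row (the `st`-predicate is preserved). [folklore] -/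
def liftV (hk : m ≤ k) (p : RowV L M k m layer) : RowV L M (k + 1) m layer :=
  ⟨⟨p.1.1, (⟨cpt (lev L k) L M p.1.2.1.1, anchor_lift L M k (le_trans (Nat.le_of_lt_succ p.1.1.isLt) hk) p.1.2.1.2⟩, p.1.2.2)⟩, by
    have hi : (p.1.1 : ℕ) ≤ k := le_trans (Nat.le_of_lt_succ p.1.1.isLt) hk
    show min (layer (blockOf (lev L (k + 1)) M (cpt (lev L k) L M p.1.2.1.1)))
        (layer (blockOf (lev L (k + 1)) M (shiftAnc (fine (lev L (k + 1)) M) (sGW L (k + 1) p.1.1) (sGW_dvd L M (k + 1) p.1.1)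
          p.1.2.2 ⟨cpt (lev L k) L M p.1.2.1.1, anchor_lift L M k hi p.1.2.1.2⟩).1)) = p.1.1
    rw [cpt_shiftAnc L M k hi, blockOf_cpt_lev, blockOf_cpt_lev]
    exact p.2⟩

/-- the descent of a vector row of level `k+1`. [folklore] -/
def dropV (hk : m ≤ k) (q : RowV L M (k + 1) m layer) : RowV L M k m layer :=
  ⟨⟨q.1.1, (⟨par (lev L k) L M q.1.2.1.1, (anchor_par L M k (le_trans (Nat.le_of_lt_succ q.1.1.isLt) hk) q.1.2.1.2).2⟩, q.1.2.2)⟩, by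
    have hi : (q.1.1 : ℕ) ≤ k := le_trans (Nat.le_of_lt_succ q.1.1.isLt) hk
    have hdv := (anchor_par L M k hi q.1.2.1.2).1
    have hz : Anchor (fine (lev L k) M) (sGW L k q.1.1) (par (lev L k) L M q.1.2.1.1) := (anchor_par L M k hi q.1.2.1.2).2
    have e : (⟨cpt (lev L k) L M (par (lev L k) L M q.1.2.1.1), anchor_lift L M k hi hz⟩ :
        Anc (fine (lev L (k + 1)) M) (sGW L (k + 1) q.1.1)) = q.1.2.1 :=
      Subtype.ext (cpt_par_of_dvd (lev L k) L M hdv)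
    have e1 := blockOf_cpt_lev L M k (par (lev L k) L M q.1.2.1.1)
    rw [cpt_par_of_dvd (lev L k) L M hdv] at e1
    have e2 := cpt_shiftAnc L M k hi q.1.2.2 ⟨par (lev L k) L M q.1.2.1.1, hz⟩
    rw [e] at e2
    have h2 := q.2
    show min (layer (blockOf (lev L k) M (par (lev L k) L M q.1.2.1.1)))
        (layer (blockOf (lev L k) M (shiftAnc (fine (lev L k) M) (sGW L k q.1.1) (sGW_dvd L M k q.1.1) q.1.2.2
          ⟨par (lev L k) L M q.1.2.1.1, hz⟩).1)) = q.1.1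
    rw [← e1, ← blockOf_cpt_lev L M k (shiftAnc (fine (lev L k) M) (sGW L k q.1.1) (sGW_dvd L M k q.1.1) q.1.2.2
      ⟨par (lev L k) L M q.1.2.1.1, hz⟩).1, ← e2]
    exact h2⟩

/-- **THE VECTOR ROW LIFT** `RowV(k) ≃ RowV(k+1)` for `k ≥ m`. [folklore] -/
def rowVLift (hk : m ≤ k) : RowV L M k m layer ≃ RowV L M (k + 1) m layer where
  toFun := liftV L M k m layer hk
  invFun := dropV L M k m layer hk
  left_inv p := Subtype.ext (Sigma.ext rfl (heq_of_eq (Prod.ext (Subtype.ext (par_cpt' (lev L k) L M p.1.2.1.1)) rfl)))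
  right_inv q := Subtype.ext (Sigma.ext rfl (heq_of_eq (Prod.ext (Subtype.ext
    (cpt_par_of_dvd (lev L k) L M (anchor_par L M k (le_trans (Nat.le_of_lt_succ q.1.1.isLt) hk) q.1.2.1.2).1)) rfl)))

end Lift

/-! ## §3 Level-`k`-indexed gauge data of level `k+1` and the split -/

section Data

variable (L : ℕ) [NeZero L] (M : Fin d → ℕ) [hM : ∀ μ, NeZero (M μ)] (k m : ℕ) (layer : Tor M → ℕ) (a a' : ℝ)

/-- **THE GAUGE COLUMNS OF THE GRADED WELL** at level `k`: `B_k = ∂·G′_GW·QsGWnᴴ` (one column per scalar row; normalised rows).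
[cite: Balaban1985BackgroundPropagators, (3.25) p.394 (shape: G′Q′*)] [folklore] -/
def BhGW : Matrix (TorK L M k × Fin d) (RowS L M k m layer) ℂ :=
  gaugeB (gradT L M k) (GOmGW L M k m layer a') (QsGWn L M k m layer)

/-- the Gram matrix `K_k = QsGWn·G′_GW²·QsGWnᴴ` at level `k`. [cite: Balaban1985BackgroundPropagators, (3.25) p.394 (shape: Q′G′²Q′*)] [folklore] -/
def KGW : Matrix (RowS L M k m layer) (RowS L M k m layer) ℂ :=
  gramK (GOmGW L M k m layer a') (QsGWn L M k m layer)

/-- the gauge columns of level `k+1` with LEVEL-`k` column indices. [folklore] -/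
def BhGWL (hk : m ≤ k) : Matrix (TorK L M (k + 1) × Fin d) (RowS L M k m layer) ℂ :=
  (BhGW L M (k + 1) m layer a').submatrix id (rowSLift L M k m layer hk)

/-- the Gram matrix of level `k+1` with level-`k` indices. [folklore] -/
def KGWL (hk : m ≤ k) : Matrix (RowS L M k m layer) (RowS L M k m layer) ℂ :=
  (KGW L M (k + 1) m layer a').submatrix (rowSLift L M k m layer hk) (rowSLift L M k m layer hk)

omit hM in
/-- reindexing the middle index of a sandwich by an `Equiv` changes nothing. [folklore] -/
theorem sandwich_submatrix {α β γ : Type*} [Fintype β] [Fintype γ] [DecidableEq β] [DecidableEq γ] (e : γ ≃ β)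
    (B : Matrix α β ℂ) (K : Matrix β β ℂ) :
    B.submatrix id e * (K.submatrix e e)⁻¹ * (B.submatrix id e)ᴴ = B * K⁻¹ * Bᴴ := by
  rw [Matrix.conjTranspose_submatrix, Matrix.inv_submatrix_equiv, Matrix.submatrix_mul_equiv, Matrix.submatrix_mul_equiv,
    Matrix.submatrix_id_id]

/-- **THE SPLIT OF LEVEL `k+1` WITH LEVEL-`k` ROW INDICES**: `regionGW(k+1) = localGW(k+1) − B′·K′⁻¹·B′ᴴ`, `B′ = BhGWL`, `K′ = KGWL`. [folklore] -/
theorem regionGW_succ_eq_localGW_sub_sandwichL (hk : m ≤ k) :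
    regionGW L M (k + 1) m layer a a'
      = localGW L M (k + 1) m layer a - BhGWL L M k m layer a' hk * (KGWL L M k m layer a' hk)⁻¹ * (BhGWL L M k m layer a' hk)ᴴ := by
  unfold BhGWL KGWL BhGW KGW
  rw [sandwich_submatrix, regionGW_eq_normalised]
  exact gaugeFixed_eq_localFixed_sub_sandwich _ _ _ _ _ _ (GOmGW_isHermitian L M (k + 1) m layer a')

/-- the split at level `k` in the same vocabulary. [folklore] -/
theorem regionGW_eq_localGW_sub_sandwich' :
    regionGW L M k m layer a a'
      = localGW L M k m layer a - BhGW L M k m layer a' * (KGW L M k m layer a')⁻¹ * (BhGW L M k m layer a')ᴴ := by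
  unfold BhGW KGW
  rw [regionGW_eq_normalised]
  exact gaugeFixed_eq_localFixed_sub_sandwich _ _ _ _ _ _ (GOmGW_isHermitian L M k m layer a')

end Data

end Summit.QuantumFields.BalabanUV.T4Continuum.GradedWellTwoLevel

end
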